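import Summits.ResolutionOfSingularities.ResolutionOfSingularities.Theorems.FrobeniusLadderFInjectiveMacaulayficationS2ModificationAffineDimTwo
import Literature.AlgebraicGeometry.Resolution.AffineDomainEquidim
import Literature.AlgebraicGeometry.Resolution.NormalizationOfVarietiesProofs
import Literature.AlgebraicGeometry.Resolution.RegularLocalRingsQuotient
import HarnessLib

/-!
# The affine S₂-modification algebra — file L3c: the clauses of `S2Modification` over `V(𝔟)`, ring level
# (crux `FInjectiveMacaulayfication` stmt-ResolutionOfSingularities-15315, chain w45a, hole #3γ, FC′ rung r2 input S-S2
# `FCForallExistsDimLe2.S2Modification`; res-L1-w45a-plan-1 R14.1 (5) «stub-3 := S2ModificationAffine L3»; memo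
# `D/res-D-pv-019/S2MOD-MEMO.md` §2 (b)(c); seat res-L1-w45a-stub-3)

[OURS · L1 W4.5a] Support file (`--supports stmt-ResolutionOfSingularities-15315 --as helper`); NOT a statement of any manuscript;
no named fact; AI-written (AI review is weaker than expert review).

For `A` a Noetherian domain of dimension `≤ 2` with fraction field `K`, `s ⊆ A ∖ 0` finite, `A′ = s2Mod A K s hs = Ā ∩ ⋂_{f ∈ s} A[1/f]`
and a prime `P ⊇ s` of `A′` (a point of `Spec A′` over `V(𝔟) = F ∩ Spec A`):

* `clauses_locSub` / **`clauses_atPrime`** — `CMClause (Localization.AtPrime P) ∧ (dim ≤ 1 → IsIntegrallyClosed (Localization.AtPrime P))`,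
  given `Ā` finite over `A` and equidimensional (maximal ideals of height `dim A`): dimension `≤ 1` from file L3a
  (`isIntegrallyClosed_locSub`, `cmClause_locSub_of_le_one`), dimension `2` from file L3b (`cmClause_locSub_of_eq_two`),
  transported along `IsLocalization.algEquiv : Localization.AtPrime P ≃ A′_P ⊆ K`;
* **`clauses_atPrime_of_finiteType`** — the same for `A` of finite type over a field `k`, the two hypotheses on `Ā` discharged by
  E. Noether's finiteness (`NoetherFiniteIntegralClosure_holds`) and equidimensionality of affine domains
  (`height_eq_ringKrullDim_of_isMaximal` + invariance of dimension under integral extensions).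

These are the two conjuncts «stalks over `F` Cohen–Macaulay» and «integrally closed when of dimension `≤ 1`» of
`FCForallExistsDimLe2.S2Modification` for the affine chart `Spec A`; NO hypothesis on `A` off `V(𝔟)` is needed for them (the
hypothesis «Cohen–Macaulay off `F`» of `S2Modification` only serves the stalk-isomorphism clause off `F`, file 1's
`exists_eq_mul_inv_pow`). The scheme-level gluing `X₃ = Spec_{X₂} 𝒜` and the discharge of `S2Modification` are file L4.
[folklore; cite: EGAIV2, 5.10.16–17; Matsumura1987, Thm. 5.6]
-/

-- single-problem summit: the doubled namespace component is forced
set_option linter.dupNamespace false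

noncomputable section

namespace Summit.ResolutionOfSingularities.ResolutionOfSingularities.Theorems.FInjectiveMacaulayfication.S2ModificationAffineClauses

open Summit.ResolutionOfSingularities.ResolutionOfSingularities.Theorems.FInjectiveMacaulayfication
open S2ModificationAffine S2ModificationAffineLocal S2ModificationAffineDimTwo nonZeroDivisors IsLocalRing

variable (A : Type) [CommRing A] [IsDomain A] (K : Type) [Field K] [Algebra A K] [IsFractionRing A K]
variable (s : Finset A) (hs : ∀ f ∈ s, f ≠ 0)

/-! ## §3 Assembly: the clauses over `V(𝔟)`, on `A′_P ⊆ K` and on `Localization.AtPrime A′ P` -/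

section Assembly

variable (P : Ideal (s2Mod A K s hs)) [P.IsPrime]

/-- **THE CLAUSES OF `S2Modification` OVER `V(𝔟)`, RING LEVEL, on `A′_P ⊆ K`.** For `A` a Noetherian domain of dimension
`≤ 2` with `Ā` finite over `A` and equidimensional (maximal ideals of height `dim A`), and a prime `P ⊇ s` of the
S₂-modification algebra `A′ = Ā ∩ ⋂_{f ∈ s} A[1/f]`: the local ring `A′_P` satisfies the Cohen–Macaulay clause, and is
integrally closed when of dimension `≤ 1`. (No hypothesis on `A` off `V(𝔟)` is used.) [folklore; cite: EGAIV2, 5.10.16–17] -/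
theorem clauses_locSub [IsNoetherianRing A] (hdimA : ringKrullDim A ≤ 2) (hfin : Module.Finite A (integralClosure A K))
    (hequi : ∀ Q : Ideal (integralClosure A K), Q.IsMaximal → (Q.height : WithBot ℕ∞) = ringKrullDim A)
    (hP : ∀ (f : A), f ∈ s → algebraMap A (s2Mod A K s hs) f ∈ P) :
    NonFullLocusClosed.CMClause (locSub A K s hs P) ∧
      (ringKrullDim (locSub A K s hs P) ≤ 1 → IsIntegrallyClosed (locSub A K s hs P)) := by
  haveI := IsLocalization.AtPrime.isLocalRing (locSub A K s hs P) P
  haveI := isIntegral_s2Mod A K s hs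
  haveI : Module.Finite A (integralClosure A K) := hfin
  haveI : Module.Finite A (s2Mod A K s hs) :=
    Module.Finite.of_injective (Subalgebra.inclusion (s2Mod_le_integralClosure A K s hs)).toLinearMap
      (fun x y hxy => Subalgebra.inclusion_injective (s2Mod_le_integralClosure A K s hs) hxy)
  haveI : IsNoetherianRing (s2Mod A K s hs) := IsNoetherianRing.of_finite A _
  haveI : IsNoetherianRing (locSub A K s hs P) := IsLocalization.isNoetherianRing P.primeCompl _ inferInstance
  -- `dim A′_P = n ≤ 2`
  obtain ⟨n, hn⟩ := Literature.AlgebraicGeometry.Resolution.exists_nat_cast_eq_ringKrullDim (R := locSub A K s hs P)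
  have hle : ringKrullDim (locSub A K s hs P) ≤ 2 := by
    rw [IsLocalization.AtPrime.ringKrullDim_eq_height P (locSub A K s hs P)]
    exact Ideal.height_le_ringKrullDim_of_isPrime.trans
      (Literature.RingTheory.KrullDimension.ringKrullDim_le_of_isIntegral.trans hdimA)
  by_cases h2 : n = 2
  · subst h2
    exact ⟨cmClause_locSub_of_eq_two A K s hs P hdimA hfin hequi hP hn, fun h1 => by
      rw [hn] at h1
      exact absurd (by exact_mod_cast h1 : (2 : ℕ) ≤ 1) (by norm_num)⟩
  · have hn1 : ringKrullDim (locSub A K s hs P) ≤ 1 := by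
      rw [hn] at hle ⊢
      have : n ≤ 2 := by exact_mod_cast hle
      have : n ≤ 1 := by omega
      exact_mod_cast this
    exact ⟨cmClause_locSub_of_le_one A K s hs P hn1, fun _ => isIntegrallyClosed_locSub A K s hs P hP hn1⟩

/-- **THE CLAUSES OF `S2Modification` OVER `V(𝔟)` ON THE ABSTRACT LOCAL RING `Localization.AtPrime A′ P`** (the shape of
the stalk of `Spec A′` at `P`), transported from `clauses_locSub` along the canonical isomorphism with `A′_P ⊆ K`
(`IsLocalization.algEquiv`). This is the ring-level form of the two conjuncts «Cohen–Macaulay over `F`» and «integrally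
closed when of dimension `≤ 1`» of `FCForallExistsDimLe2.S2Modification`, for the affine chart `Spec A` with
`F ∩ Spec A = V(s)`; the scheme-level gluing is file L4. [folklore; cite: EGAIV2, 5.10.16–17] -/
theorem clauses_atPrime [IsNoetherianRing A] (hdimA : ringKrullDim A ≤ 2) (hfin : Module.Finite A (integralClosure A K))
    (hequi : ∀ Q : Ideal (integralClosure A K), Q.IsMaximal → (Q.height : WithBot ℕ∞) = ringKrullDim A)
    (hP : ∀ (f : A), f ∈ s → algebraMap A (s2Mod A K s hs) f ∈ P) :
    NonFullLocusClosed.CMClause (Localization.AtPrime P) ∧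
      (ringKrullDim (Localization.AtPrime P) ≤ 1 →
        IsIntegrallyClosed (Localization.AtPrime P)) := by
  obtain ⟨hCM, hIC⟩ := clauses_locSub A K s hs P hdimA hfin hequi hP
  let e : Localization.AtPrime P ≃ₐ[s2Mod A K s hs] locSub A K s hs P :=
    IsLocalization.algEquiv P.primeCompl _ _
  refine ⟨FiLocusOpenOfAffine.cmClause_of_ringEquiv e.symm.toRingEquiv hCM, fun h1 => ?_⟩
  haveI : IsIntegrallyClosed (locSub A K s hs P) :=
    hIC (by rwa [← ringKrullDim_eq_of_ringEquiv e.toRingEquiv])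
  exact IsIntegrallyClosed.of_equiv e.symm.toRingEquiv

/-- **THE SAME, WITH THE FINITENESS AND EQUIDIMENSIONALITY HYPOTHESES DISCHARGED FOR AFFINE DOMAINS**: for a domain `A` of
finite type over a field `k` with `dim A ≤ 2` (fraction field `K` a `k`-algebra compatibly), `s ⊆ A ∖ 0` finite and a prime
`P ⊇ s` of `A′ = Ā ∩ ⋂_{f ∈ s} A[1/f]`: `Localization.AtPrime A′ P` satisfies the Cohen–Macaulay clause and is integrally closed
when of dimension `≤ 1`. Finiteness of `Ā` is E. Noether's theorem (`NoetherFiniteIntegralClosure_holds`), equidimensionality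
of the affine domain `Ā` is `height_eq_ringKrullDim_of_isMaximal` + invariance of dimension under integral extensions.
[folklore; cite: EGAIV2, 5.10.16–17; Matsumura1987, Thm. 5.6] -/
theorem clauses_atPrime_of_finiteType (k : Type) [Field k] [Algebra k A] [Algebra.FiniteType k A]
    [Algebra k K] [IsScalarTower k A K] (hdimA : ringKrullDim A ≤ 2)
    (hP : ∀ (f : A), f ∈ s → algebraMap A (s2Mod A K s hs) f ∈ P) :
    NonFullLocusClosed.CMClause (Localization.AtPrime P) ∧
      (ringKrullDim (Localization.AtPrime P) ≤ 1 →
        IsIntegrallyClosed (Localization.AtPrime P)) := by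
  haveI : IsNoetherianRing A := Algebra.FiniteType.isNoetherianRing k A
  haveI hfin : Module.Finite A (integralClosure A K) :=
    Literature.AlgebraicGeometry.Resolution.NoetherFiniteIntegralClosure_holds.self k A K
  refine clauses_atPrime A K s hs P hdimA hfin (fun Q hQ => ?_) hP
  haveI := hQ
  haveI : Algebra.FiniteType k (integralClosure A K) :=
    Algebra.FiniteType.trans (S := A) inferInstance inferInstance
  rw [Literature.AlgebraicGeometry.Resolution.height_eq_ringKrullDim_of_isMaximal k Q]
  exact (Literature.RingTheory.KrullDimension.ringKrullDim_eq_of_isIntegral (R := A)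
    (S := integralClosure A K) (fun x y hxy => by
      have := congrArg (fun z : integralClosure A K => (z : K)) hxy
      exact IsFractionRing.injective A K this)).symm

end Assembly

end Summit.ResolutionOfSingularities.ResolutionOfSingularities.Theorems.FInjectiveMacaulayfication.S2ModificationAffineClauses

end
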